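import Mathlib
import HarnessLib
import Literature.Analysis.FluidPDE.Tao2016AveragedNS.TaylorChainCertificate
import Summits.NavierStokesRegularity.NavierStokesRegularity.Theorems.TaylorModelRungThreeReadoutChainTools

/-!
# Line `taylor-model` on crux K1b-DR (stmt-NavierStokesRegularity-23954) — stub G1 (`ChainEnclosureHolds`),
# helper 2: the Lohner NODE STEP of the Taylor-model chain

The heart of the chain-enclosure induction (G-PROOFPLAN §1), for an ARBITRARY flow package `φ`
(`IsFlowPackage cd φ`) and a certificate obeying `Chain`: at stage `j`, sub-step `s < S j`, a state whose window
part is `x j s + Cm j s ξ + e` with `|ξ| ≤ rP j s` (frame coordinates), frame part of weighted size `f` and error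
`e` of size `ε`, `f + ε ≤ ρO j s`, is carried by the flow over the sub-step (`h j s`) to
`x j (s+1) + Cm j (s+1) ξ' + e'` with the NEW frame coordinates `ξ' := Ci j (s+1) (Vap j s (h j s) (Cm j s ξ))`,
`|ξ'| ≤ rP j (s+1)` (the certificate's parallelepiped transport clause), and the new error bounded by
`dP + NVh·ε + Rem + RemV·(f+ε) + Dev(f+ε)` (`node_step`); inside the sub-step the state stays in
`TP j s u + Ball(NV·(f+ε) + Rem(u) + RemV(u)·(f+ε) + Dev(f+ε,u))` (`inStep_bound`). Ingredients: F5a/F5b of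
the package at the centre `x j s`, window congruence (`stAt_congr_window`), linearity and window support of
`Vap` (`Vap_add`, `Vap_trunc`, `wsupp_Vap`), the exact frame inverse `Cm (Ci v) = v` on window vectors, and the
step clauses `dP`, `NV`, `NVh` of `Chain`.

MODEL-lattice bookkeeping only (rung TL-M3); nothing here is a statement about the Navier–Stokes equations.
-/

noncomputable section

-- the sub-problem namespace repeats the summit name by design (D-0017)
set_option linter.dupNamespace false

namespace Summit.NavierStokesRegularity.NavierStokesRegularity.Theorems.TaylorModelReadout

open scoped BigOperators
open Set Finset Literature.Analysis.FluidPDE.TaoCascade Literature.Analysis.FluidPDE.TaoCascade.TaylorChain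

variable {cd : CertData} {φ : Flow}

/-- Radii equal up to rearrangement. [folklore] -/
theorem inBall_of_eq {j : ℕ} {y : Fin 4 → ℤ → ℝ} {N N' : ℝ} (h : cd.InBall j y N) (e : N = N') :
    cd.InBall j y N' := e ▸ h

section Step

variable (hF : IsFlowPackage cd φ) (hV : cd.Valid) {j : ℕ} (hj : j ≤ cd.N₀) {s : ℕ} (hs : s < cd.S j)
  {f ε : ℝ} (hf : 0 ≤ f) (hε : 0 ≤ ε) (hfe : f + ε ≤ cd.ρO j s)
  {y ξ e : Fin 4 → ℤ → ℝ} (hξ : ∀ i k, -cd.Kb ≤ k → k ≤ cd.Ka → |ξ i k| ≤ cd.rP j s i k)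
  (hCmξ : cd.InBall j (cd.Cm j s ξ) f) (he : cd.InBall j e ε)
  (hy : ∀ i k, -cd.Kb ≤ k → k ≤ cd.Ka → y i k = cd.x j s i k + cd.Cm j s ξ i k + e i k)
include hF hV hj hs hf hε hfe hξ hCmξ he hy

omit hξ in
/-- **Set-up of the step.** The variation `v := trunc y − x j s` is window-supported, equals
`Cm ξ + trunc e`, has weighted size `f + ε`, and the flow from `y` is the flow from `x j s + v` on the
sub-step (window congruence under the guard `bb (mC + ρO) h < 1`). [folklore] -/
theorem step_setup :
    cd.Wsupp (trunc cd y - cd.x j s) ∧ trunc cd y - cd.x j s = cd.Cm j s ξ + trunc cd e ∧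
    cd.InBall j (trunc cd y - cd.x j s) (f + ε) ∧
    ∀ u ∈ Icc 0 (cd.h j s), stAt φ j y u = stAt φ j (cd.x j s + (trunc cd y - cd.x j s)) u := by
  obtain ⟨-, hN, hC, -⟩ := hV
  obtain ⟨-, -, -, -, -, -, hA, hB⟩ := hC j hj
  obtain ⟨a1, -, a3, a4, -, -, -, -, -, -, -, -, -, a14, -⟩ := hA s hs.le
  obtain ⟨b1, -, b3, -⟩ := hB s hs
  have hbb : 0 ≤ cd.bb j := (hN.2 j hj).1
  -- window support and the splitting
  have hsplit : trunc cd y - cd.x j s = cd.Cm j s ξ + trunc cd e := by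
    funext i k
    by_cases hk : -cd.Kb ≤ k ∧ k ≤ cd.Ka
    · simp only [Pi.sub_apply, Pi.add_apply, trunc_apply, hk, and_self, ↓reduceIte, hy i k hk.1 hk.2]
      ring
    · simp only [Pi.sub_apply, Pi.add_apply, trunc_apply, hk, ↓reduceIte, a1 i k hk, (a14 ξ).1 i k hk]
      ring
  have hws : cd.Wsupp (trunc cd y - cd.x j s) := by
    intro i k hk
    rw [hsplit]
    show cd.Cm j s ξ i k + trunc cd e i k = 0
    rw [(a14 ξ).1 i k hk, trunc_apply, if_neg hk, add_zero]
  have hvb : cd.InBall j (trunc cd y - cd.x j s) (f + ε) := by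
    rw [hsplit]; exact inBall_add hCmξ (inBall_trunc_iff.2 he)
  refine ⟨hws, hsplit, hvb, fun u hu => ?_⟩
  -- window congruence: `y` and `x + v = trunc y` agree on the window
  have hxv : cd.x j s + (trunc cd y - cd.x j s) = trunc cd y := by abel
  rw [hxv]
  have hym : cd.InBall j y (cd.mC j s + (f + ε)) := by
    have h1 : cd.InBall j (cd.x j s + (trunc cd y - cd.x j s)) (cd.mC j s + (f + ε)) := inBall_add a4 hvb
    rw [hxv] at h1
    exact inBall_trunc_iff.1 h1
  have hm0 : 0 ≤ cd.mC j s + (f + ε) := by linarith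
  have hg : cd.bb j * (cd.mC j s + (f + ε)) * cd.h j s < 1 := by
    have h1 : cd.bb j * (cd.mC j s + (f + ε)) * cd.h j s ≤ cd.bb j * (cd.mC j s + cd.ρO j s) * cd.h j s := by
      have : 0 ≤ cd.bb j * cd.h j s := mul_nonneg hbb b1.le
      nlinarith
    exact lt_of_le_of_lt h1 b3
  exact stAt_congr_window hF hj (fun i k h1 h2 => by simp [trunc, h1, h2]) hm0 hym b1.le hg hu

omit hξ in
/-- **In-step enclosure.** For `u ∈ [0, h j s]` the state lies in
`TP j s u + Ball(NV·(f+ε) + Rem(u) + RemV(u)·(f+ε) + Dev(f+ε,u))`. [cite: Zgliczynski2002C1Lohner, §3–4] -/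
theorem inStep_bound {u : ℝ} (hu : u ∈ Icc 0 (cd.h j s)) :
    cd.InBall j (stAt φ j y u - cd.TP j s u)
      (cd.NV j s * (f + ε) + cd.Rem (cd.bb j) (cd.mC j s) u + cd.RemV (cd.bb j) (cd.mC j s) u * (f + ε) +
        CertData.Dev (cd.bb j) (cd.mC j s) (f + ε) u) := by
  obtain ⟨hws, -, hvb, hflow⟩ := step_setup hF hV hj hs hf hε hfe hCmξ he hy
  obtain ⟨-, -, hC, -⟩ := hV
  obtain ⟨-, -, -, -, -, -, hA, hB⟩ := hC j hj
  obtain ⟨-, -, -, -, -, -, -, -, -, hB10, -⟩ := hB s hs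
  obtain ⟨hF5a, hF5b, -⟩ := (hF j hj).2.2.2.2.2 s hs
  obtain ⟨v, hv⟩ : ∃ v : Fin 4 → ℤ → ℝ, v = trunc cd y - cd.x j s := ⟨_, rfl⟩
  rw [← hv] at hws hvb hflow
  have h1 := hF5b v (f + ε) (by linarith) hfe hvb hws u hu
  have h2 := hF5a u hu
  have h3 := hB10 u hu v (f + ε) (by linarith) hvb
  rw [hflow u hu]
  have e1 : stAt φ j (cd.x j s + v) u - cd.TP j s u =
      cd.Vap j s u v + ((stAt φ j (cd.x j s) u - cd.TP j s u) +
        (stAt φ j (cd.x j s + v) u - stAt φ j (cd.x j s) u - cd.Vap j s u v)) := by abel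
  rw [e1]
  exact inBall_of_eq (inBall_add h3 (inBall_add h2 h1)) (by ring)

/-- **THE NODE STEP (generic level `(f, ε)`).** New frame coordinates
`ξ' := Ci j (s+1) (Vap j s (h j s) (Cm j s ξ))` obey `|ξ'| ≤ rP j (s+1)`, and the new error
`stAt φ j y (h j s) − x j (s+1) − Cm j (s+1) ξ'` has weighted size at most
`dP + NVh·ε + Rem + RemV·(f+ε) + Dev(f+ε)`. [cite: Zgliczynski2002C1Lohner, §3–4] -/
theorem node_step :
    (∀ i k, -cd.Kb ≤ k → k ≤ cd.Ka →
        |cd.Ci j (s + 1) (cd.Vap j s (cd.h j s) (cd.Cm j s ξ)) i k| ≤ cd.rP j (s + 1) i k) ∧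
    cd.InBall j (stAt φ j y (cd.h j s) - cd.x j (s + 1) -
        cd.Cm j (s + 1) (cd.Ci j (s + 1) (cd.Vap j s (cd.h j s) (cd.Cm j s ξ))))
      (cd.dP j s + cd.NVh j s * ε + cd.Rem (cd.bb j) (cd.mC j s) (cd.h j s) +
        cd.RemV (cd.bb j) (cd.mC j s) (cd.h j s) * (f + ε) +
        CertData.Dev (cd.bb j) (cd.mC j s) (f + ε) (cd.h j s)) := by
  obtain ⟨hws, hsplit, hvb, hflow⟩ := step_setup hF hV hj hs hf hε hfe hCmξ he hy
  obtain ⟨-, -, hC, -⟩ := hV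
  obtain ⟨-, -, -, -, -, -, hA, hB⟩ := hC j hj
  obtain ⟨-, -, -, -, -, -, -, -, -, -, -, -, -, a14, -, -, a17, a18, a19, a20⟩ := hA s hs.le
  obtain ⟨-, -, -, -, -, -, -, -, -, -, -, -, -, a14', -⟩ := hA (s + 1) hs
  obtain ⟨b1, -, -, -, -, -, -, -, -, -, -, hB12, hB13, -, -, -, -, -, -, -, hB21, -⟩ := hB s hs
  obtain ⟨hF5a, hF5b, -⟩ := (hF j hj).2.2.2.2.2 s hs
  have hh : cd.h j s ∈ Icc 0 (cd.h j s) := ⟨b1.le, le_rfl⟩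
  -- jet identification at the centre `x j s` (for `Vap` linearity / support)
  have hPj : ∀ n, n ≤ cd.pdeg → toVec cd (cd.P j s n) = taylorJet (Qw cd) (toVec cd (cd.x j s)) n :=
    toVec_table_eq_taylorJet a17 a18
  refine ⟨fun i k hk1 hk2 => hB21 ξ hξ i k hk1 hk2, ?_⟩
  obtain ⟨v, hv⟩ : ∃ v : Fin 4 → ℤ → ℝ, v = trunc cd y - cd.x j s := ⟨_, rfl⟩
  rw [← hv] at hws hsplit hvb hflow
  obtain ⟨w, hw⟩ : ∃ w : Fin 4 → ℤ → ℝ, w = cd.Vap j s (cd.h j s) (cd.Cm j s ξ) := ⟨_, rfl⟩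
  -- `Cm (Ci w) = w` since `w` is window-supported
  have hww : cd.Wsupp w := by rw [hw]; exact wsupp_Vap a19 a20 _ _
  have hCmCi : cd.Cm j (s + 1) (cd.Ci j (s + 1) w) = w := ((a14' w).2.2 hww).2
  -- the pieces
  have h1 := hF5b v (f + ε) (by linarith) hfe hvb hws (cd.h j s) hh
  have h2 := hF5a (cd.h j s) hh
  have h3 : cd.InBall j (cd.Vap j s (cd.h j s) (trunc cd e)) (cd.NVh j s * ε) :=
    hB12 (trunc cd e) ε hε (inBall_trunc_iff.2 he)
  have hVsplit : cd.Vap j s (cd.h j s) v = w + cd.Vap j s (cd.h j s) (trunc cd e) := by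
    rw [hsplit, Vap_add a19 a20 hPj, hw]
  rw [← hw, hflow (cd.h j s) hh, hCmCi]
  have e1 : stAt φ j (cd.x j s + v) (cd.h j s) - cd.x j (s + 1) - w =
      (cd.TP j s (cd.h j s) - cd.x j (s + 1)) + (cd.Vap j s (cd.h j s) (trunc cd e) +
        ((stAt φ j (cd.x j s) (cd.h j s) - cd.TP j s (cd.h j s)) +
          (stAt φ j (cd.x j s + v) (cd.h j s) - stAt φ j (cd.x j s) (cd.h j s) - cd.Vap j s (cd.h j s) v))) := by
    rw [hVsplit]; abel
  rw [e1]
  exact inBall_of_eq (inBall_add hB13 (inBall_add h3 (inBall_add h2 h1))) (by ring)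

end Step

end Summit.NavierStokesRegularity.NavierStokesRegularity.Theorems.TaylorModelReadout

end
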